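import Literature.Topology.FourManifolds.RegularLevelSplitting
import Literature.Topology.FourManifolds.RegularLevelMorseData
import Literature.Topology.FourManifolds.RegularSublevelAmbient
import Literature.Topology.FourManifolds.LevelTransversality
import Literature.Topology.FourManifolds.AdaptedMorseConnected
import Literature.Topology.FourManifolds.ImmersionCriterion
import Literature.Topology.FourManifolds.ThickenedPlanarHandlebody
import Literature.Topology.FourManifolds.LatticeFormsDefinite
import Literature.Topology.FourManifolds.Trisections
import Literature.Topology.FourManifolds.SmoothOrientationSphereProofs
import Literature.Topology.FourManifolds.SpinDiffeomorphProofs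
import Literature.Topology.FourManifolds.SPC4HandlesTwoHandlebodyProofs
import Literature.Topology.FourManifolds.SPC4HandlesTwoLeaves
import Literature.Topology.FourManifolds.CorkDecomposition
import Mathlib.Geometry.Manifold.Instances.Sphere
import Mathlib.Analysis.Calculus.FDeriv.Pow
import Mathlib.LinearAlgebra.QuadraticForm.Signature
import HarnessLib

/-!
# The genus-one splitting of the 4-sphere `S⁴ = (S² × D²) ∪ (S¹ × B³)`, and 4-sphere recognition
# from such a splitting (modulo Laudenbach–Poénaru)

Topic `Literature/Topology/FourManifolds`; brick for the named fact
`Literature.Topology.FourManifolds.nonempty_diffeomorph_sphere_four_of_sblf_genus_one_noLefschetz`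
(Baykur–Kamada 2015, Lemma 11 with Cor. 14: a simply connected closed 4-manifold with a genus-one
simplified broken Lefschetz fibration without Lefschetz points is `S⁴`).  Everything in this file
is **proved**; the `def`s are concrete subsets of `ℝ⁵` and concrete functions; no named fact is
introduced.

## The printed step

Auroux–Donaldson–Katzarkov, *Singular Lefschetz pencils*, Geom. Topol. 9 (2005), §8.2,
Example 1 (the genus-one broken fibration of `S⁴`), last sentence of the argument: *"Therefore,
we now have `X_- ∪ W ≃ S¹ × B³`, and by gluing `X_+ = D² × S²` along the boundary we obtain
`X' ≃ S⁴`."*  Equally Baykur–Kamada (2015), §5 ("One round singular circle, no Lefschetz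
singularity"), case `n = 1` of the Kirby calculus: the lower side `S² × D²` closes the
complement `S¹ × B³` up to `S⁴` for both parities of the framing.  The implicit input is that it
does not matter *how* `D² × S²` is glued to `S¹ × B³`: every self-diffeomorphism of
`∂(S¹ × B³) = S¹ × S²` extends over `S¹ × B³` — the case `k = 1` of Laudenbach–Poénaru (1972),
the tree's named fact `Literature.Topology.FourManifolds.exists_diffeomorph_comp_incl_eq` — so
that `(S¹ × B³) ∪_φ (S² × D²) ≅ (S¹ × B³) ∪_{id} (S² × D²) = ∂(D² × B³) = S⁴`
(Gompf–Stipsicz 1999, §4.4; Kirby 1989, Ch. I §2, p. 8).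

## What is proved

* §1–§3 **The model.**  `S := {x ∈ ℝ⁵ | Σ xᵢ² = 1}` as a regular level
  (`Literature.Topology.FourManifolds.RegularLevel`) of the square norm on `ℝ⁵`, a closed
  4-manifold diffeomorphic to Mathlib's unit sphere `𝕊⁴` (`sphereLevelDiffeomorph`, by the
  tree's presentation of regular levels, `IsRegularLevel.presentationHomeomorph`); the function
  `u = x₃² + x₄²` on `S`, whose level `1/2` is regular; the **tube about the equatorial
  2-sphere** `W₀ = {u ≤ 1/2} ≅ S² × D²` and the **tube about the polar circle**
  `V₀ = {u ≥ 1/2} ≅ S¹ × B³`, compact 4-manifolds with boundary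
  (`Literature.Topology.FourManifolds.RegularSublevel` / `RegularSuperlevel`), and the splitting
  `S = W₀ ∪_{u = 1/2} V₀` (`RegularSublevel.isBoundaryGluing_split`; Milnor 1963, Thm. 3.1).
* §4–§6 **`V₀` is a compact connected orientable `1`-handlebody with one `0`-handle and one
  `1`-handle** (`hasHandleDecomposition_polarTube : HasHandleDecomposition 3 V₀ (handleCount 1 1)`):
  the Morse function adapted to `∂V₀` is `3/2 - G`, `G = u + η (2u - 1) x₃` (`η = 1/10`; the tilt
  `η (2u - 1) x₃` vanishes on `∂V₀` and breaks the critical circle `{u = 1}` of `u` into the two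
  nondegenerate critical points `± e₃`), whose critical points on `V₀` are `e₃` (index `0`, the
  minimum) and `-e₃` (index `1`): Lagrange multipliers on the level `S` read in the identity
  chart of `ℝ⁵` (`RegularLevel.isMCriticalPt_comp_incl_iff_of_chart`,
  `RegularLevel.morseIndex_comp_incl_eq`, Milnor 1963, §2) and transfer to the regular domain
  `V₀ ⊆ S` (`RegularSublevel.isMCriticalPt_comp_incl_iff`, `RegularSublevel.morseIndex_comp_incl_eq`,
  Milnor 1963, Thm. 3.1).  Connectedness is Reeb's argument
  (`HasHandleDecomposition.connectedSpace`), orientability is pulled back from `𝕊⁴`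
  (`isOrientable_sphere_holds`).
* §7 **4-sphere recognition from a genus-one splitting, modulo Laudenbach–Poénaru**
  (`nonempty_diffeomorph_sphere_four_of_isBoundaryGluing_equatorTube`): granted
  `exists_diffeomorph_comp_incl_eq`, a closed smooth 4-manifold `X` which is a boundary gluing
  `W₀ ∪_φ V` of the tube `W₀` and ANY compact connected orientable 4-manifold with boundary `V`
  carrying a handle decomposition with one `0`-handle and one `1`-handle (i.e. `V ≅ S¹ × B³`,
  Kosinski 1993, VI (11.4)(c) — the tree's PROVED
  `nonempty_diffeomorph_of_hasHandleDecomposition_handleCount_one_holds`) is diffeomorphic to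
  `𝕊⁴`: `V₀ ≅ V` by that classification, then Kirby's sentence
  `nonempty_diffeomorph_of_isBoundaryGluing_of_laudenbachPoenaru_of_diffeomorph`
  (`SPC4HandlesTwoHandlebodyProofs.lean`; Matsumoto 2001, Lemma 5.20) and `S ≅ 𝕊⁴`.  The variant
  `…_of_diffeomorph` takes the `S² × D²` piece up to a diffeomorphism onto `W₀`
  (`IsBoundaryGluing.transfer`).

For the Baykur–Kamada fact this is the closed form of the endgame: with the lower side of the
fibration identified with `W₀` (the tree's fibrewise product structure
`IsSimplifiedBrokenLefschetzFibration.exists_pole_isSmoothEmbedding_sphere_two_prod_side`,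
`SimplifiedBrokenLefschetzSidesGenus.lean`) it reduces the fact to Laudenbach–Poénaru and to the
statement that the complement of the sphere side is an orientable `(1,1)`-handlebody
(Auroux–Donaldson–Katzarkov's "`X_- ∪ W ≃ S¹ × B³`").

## References

* D. Auroux, S. K. Donaldson, L. Katzarkov, *Singular Lefschetz pencils*, Geom. Topol. 9 (2005)
  1043–1114, §8.2, Example 1. [AurouxDonaldsonKatzarkov2005]
* R. İ. Baykur, S. Kamada, *Classification of broken Lefschetz fibrations with small fiber
  genera*, J. Math. Soc. Japan 67 (2015) 877–901, §5, Lemma 11, Cor. 14. [BaykurKamada2015]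
* F. Laudenbach, V. Poénaru, *A note on 4-dimensional handlebodies*, Bull. Soc. Math. France
  100 (1972) 337–344. [LaudenbachPoenaruBSMF1972]
* R. Gompf, A. Stipsicz, *4-Manifolds and Kirby Calculus*, GSM 20 (1999), §4.4.
  [GompfStipsicz1999]
* J. Milnor, *Morse theory*, Ann. of Math. Studies 51 (1963), §2, Thm. 3.1. [Milnor1963]
* A. A. Kosinski, *Differential Manifolds* (1993), VI (11.4)(c). [Kosinski1993]
* Y. Matsumoto, *An Introduction to Morse Theory* (2001), Lemma 5.20. [Matsumoto2001]
-/

open scoped Manifold ContDiff Topology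
open Set Function Filter Metric Module

noncomputable section

namespace Literature.Topology.FourManifolds

/-- Local notation: `𝔼 n` is the model Euclidean space `EuclideanSpace ℝ (Fin n)`. -/
local notation "𝔼 " n:arg => EuclideanSpace ℝ (Fin n)

/-- Local notation: `𝕊 n` is the unit sphere in `EuclideanSpace ℝ (Fin (n + 1))`. -/
local notation "𝕊 " n:arg => (Metric.sphere (0 : EuclideanSpace ℝ (Fin (n + 1))) 1)

attribute [local instance] fact_finrank_euclideanSpace_succ

namespace SphereFourSplitting

/-! ### §1 Calculus on `ℝ⁵`: the square norm, the tube function and the tilted tube function -/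

/-- The coordinate functionals `πᵢ : ℝ⁵ →L ℝ`. [folklore] -/
abbrev π (i : Fin 5) : (𝔼 5) →L[ℝ] ℝ := EuclideanSpace.proj i

/-- `πᵢ v = vᵢ` (definitional). [folklore] -/
@[simp] theorem π_apply (i : Fin 5) (v : 𝔼 5) : π i v = v i := rfl

/-- The coordinate functions are differentiable with differential `πᵢ`. [folklore] -/
theorem hasFDerivAt_coord (i : Fin 5) (p : 𝔼 5) : HasFDerivAt (fun q : 𝔼 5 => q i) (π i) p := by
  have h := (π i).hasFDerivAt (x := p)
  rwa [EuclideanSpace.coe_proj] at h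

/-- **The square norm** `N(x) = x₀² + x₁² + x₂² + x₃² + x₄²` on `ℝ⁵` (written out in
coordinates). [folklore] -/
def sqNorm (p : 𝔼 5) : ℝ := p 0 ^ 2 + p 1 ^ 2 + p 2 ^ 2 + p 3 ^ 2 + p 4 ^ 2

/-- The square norm is `‖x‖²`. [folklore] -/
theorem sqNorm_eq_norm_sq (p : 𝔼 5) : sqNorm p = ‖p‖ ^ 2 := by
  rw [EuclideanSpace.norm_sq_eq, Fin.sum_univ_five]
  simp [Real.norm_eq_abs, sq_abs, sqNorm]

/-- The differential of the square norm, `dN(p) = 2 Σ pᵢ dxᵢ`. [folklore] -/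
def dSqNorm (p : 𝔼 5) : (𝔼 5) →L[ℝ] ℝ :=
  (2 * p 0) • π 0 + (2 * p 1) • π 1 + (2 * p 2) • π 2 + (2 * p 3) • π 3 + (2 * p 4) • π 4

/-- `dN(p)` evaluated. [folklore] -/
@[simp] theorem dSqNorm_apply (p v : 𝔼 5) :
    dSqNorm p v = 2 * p 0 * v 0 + 2 * p 1 * v 1 + 2 * p 2 * v 2 + 2 * p 3 * v 3 + 2 * p 4 * v 4 := by
  simp [dSqNorm, smul_eq_mul]

/-- `N` is differentiable with differential `dSqNorm`. [folklore] -/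
theorem hasFDerivAt_sqNorm (p : 𝔼 5) : HasFDerivAt sqNorm (dSqNorm p) p := by
  have h0 := hasFDerivAt_coord 0 p
  have h1 := hasFDerivAt_coord 1 p
  have h2 := hasFDerivAt_coord 2 p
  have h3 := hasFDerivAt_coord 3 p
  have h4 := hasFDerivAt_coord 4 p
  have h := ((((h0.pow 2).add (h1.pow 2)).add (h2.pow 2)).add (h3.pow 2)).add (h4.pow 2)
  have h' : HasFDerivAt sqNorm _ p := h.congr_of_eventuallyEq (Eventually.of_forall fun q => rfl)
  refine h'.congr_fderiv ?_
  ext v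
  simp [dSqNorm, smul_eq_mul]

/-- `fderiv N = dSqNorm`. [folklore] -/
theorem fderiv_sqNorm : fderiv ℝ sqNorm = dSqNorm := funext fun p => (hasFDerivAt_sqNorm p).fderiv

/-- `N` is smooth. [folklore] -/
theorem contDiff_sqNorm : ContDiff ℝ ∞ sqNorm := by
  unfold sqNorm
  fun_prop

/-- **The tube function** `u(x) = x₃² + x₄²` on `ℝ⁵` (square distance from the equatorial
`3`-plane `{x₃ = x₄ = 0}`): on the unit sphere its level `1/2` separates the tube about the
equatorial `2`-sphere from the tube about the polar circle `{x₀ = x₁ = x₂ = 0}`. [folklore] -/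
def tubeFn (p : 𝔼 5) : ℝ := p 3 ^ 2 + p 4 ^ 2

/-- The differential of the tube function, `du(p) = 2 p₃ dx₃ + 2 p₄ dx₄`. [folklore] -/
def dTubeFn (p : 𝔼 5) : (𝔼 5) →L[ℝ] ℝ := (2 * p 3) • π 3 + (2 * p 4) • π 4

/-- `du(p)` evaluated. [folklore] -/
@[simp] theorem dTubeFn_apply (p v : 𝔼 5) : dTubeFn p v = 2 * p 3 * v 3 + 2 * p 4 * v 4 := by
  simp [dTubeFn, smul_eq_mul]

/-- `u` is differentiable with differential `dTubeFn`. [folklore] -/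
theorem hasFDerivAt_tubeFn (p : 𝔼 5) : HasFDerivAt tubeFn (dTubeFn p) p := by
  have h3 := hasFDerivAt_coord 3 p
  have h4 := hasFDerivAt_coord 4 p
  have h := (h3.pow 2).add (h4.pow 2)
  have h' : HasFDerivAt tubeFn _ p := h.congr_of_eventuallyEq (Eventually.of_forall fun q => rfl)
  refine h'.congr_fderiv ?_
  ext v
  simp [dTubeFn, smul_eq_mul]

/-- `fderiv u = dTubeFn`. [folklore] -/
theorem fderiv_tubeFn : fderiv ℝ tubeFn = dTubeFn := funext fun p => (hasFDerivAt_tubeFn p).fderiv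

/-- `u` is smooth. [folklore] -/
theorem contDiff_tubeFn : ContDiff ℝ ∞ tubeFn := by
  unfold tubeFn
  fun_prop

/-- The tilt parameter `η = 1/10`. [folklore] -/
def η : ℝ := 1 / 10

/-- `η = 1/10`. [folklore] -/
theorem η_eq : η = 1 / 10 := rfl

/-- `0 < η`. [folklore] -/
theorem η_pos : 0 < η := by rw [η_eq]; norm_num

/-- **The tilted tube function** `G(x) = u + η (2u - 1) x₃ = x₃² + x₄² + η (2x₃² + 2x₄² - 1) x₃`:
the tilt vanishes on the level `{u = 1/2}` and breaks the critical circle `{u = 1}` of `u|S⁴`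
into two nondegenerate critical points `± e₃`. [folklore] -/
def tiltFn (p : 𝔼 5) : ℝ := p 3 ^ 2 + p 4 ^ 2 + η * (2 * (p 3 ^ 2 + p 4 ^ 2) - 1) * p 3

/-- `G = u + η (2u - 1) x₃`. [folklore] -/
theorem tiltFn_eq (p : 𝔼 5) : tiltFn p = tubeFn p + η * (2 * tubeFn p - 1) * p 3 := rfl

/-- `∂G/∂x₃ = 2x₃ + 6η x₃² + 2η x₄² - η`. [folklore] -/
def tiltA (p : 𝔼 5) : ℝ := 2 * p 3 + 6 * η * p 3 ^ 2 + 2 * η * p 4 ^ 2 - η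
/-- `∂G/∂x₄ = 2x₄ + 4η x₃ x₄`. [folklore] -/
def tiltB (p : 𝔼 5) : ℝ := 2 * p 4 + 4 * η * p 3 * p 4

/-- The differential of `G`, `dG = G₃ dx₃ + G₄ dx₄`. [folklore] -/
def dTiltFn (p : 𝔼 5) : (𝔼 5) →L[ℝ] ℝ := tiltA p • π 3 + tiltB p • π 4

/-- `dG(p)` evaluated. [folklore] -/
@[simp] theorem dTiltFn_apply (p v : 𝔼 5) : dTiltFn p v = tiltA p * v 3 + tiltB p * v 4 := by
  simp [dTiltFn, smul_eq_mul]

/-- `G` is differentiable with differential `dTiltFn`. [folklore] -/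
theorem hasFDerivAt_tiltFn (p : 𝔼 5) : HasFDerivAt tiltFn (dTiltFn p) p := by
  have h3 := hasFDerivAt_coord 3 p
  have h4 := hasFDerivAt_coord 4 p
  have hs : HasFDerivAt (fun q : 𝔼 5 => q 3 ^ 2 + q 4 ^ 2) ((2 * p 3) • π 3 + (2 * p 4) • π 4) p := by
    have h := (h3.pow 2).add (h4.pow 2)
    have h' : HasFDerivAt (fun q : 𝔼 5 => q 3 ^ 2 + q 4 ^ 2) _ p :=
      h.congr_of_eventuallyEq (Eventually.of_forall fun q => rfl)
    refine h'.congr_fderiv ?_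
    ext v
    simp [smul_eq_mul]
  have h := hs.add ((((hs.const_mul 2).sub_const 1).const_mul η).mul h3)
  have h' : HasFDerivAt tiltFn _ p := h.congr_of_eventuallyEq (Eventually.of_forall fun q => rfl)
  refine h'.congr_fderiv ?_
  ext v
  simp [dTiltFn, tiltA, tiltB, smul_eq_mul]
  ring

/-- `fderiv G = dTiltFn`. [folklore] -/
theorem fderiv_tiltFn : fderiv ℝ tiltFn = dTiltFn := funext fun p => (hasFDerivAt_tiltFn p).fderiv

/-- `G` is smooth. [folklore] -/
theorem contDiff_tiltFn : ContDiff ℝ ∞ tiltFn := by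
  unfold tiltFn
  fun_prop

/-! #### The ambient comparison function `F_ν = 3/2 - G - ν (N - 1)` and its two derivatives -/

/-- **The ambient function** `F_ν(x) = 3/2 - G(x) - ν (N(x) - 1)`: for every multiplier `ν` it
restricts to `3/2 - G` on the unit sphere `{N = 1}`; `ν` is chosen so that `F_ν` is critical on
`ℝ⁵` at the point under study (Lagrange). [folklore] -/
def ambFn (ν : ℝ) (p : 𝔼 5) : ℝ := 3 / 2 - tiltFn p - ν * (sqNorm p - 1)

/-- `F_ν` is smooth. [folklore] -/
theorem contDiff_ambFn (ν : ℝ) : ContDiff ℝ ∞ (ambFn ν) := by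
  unfold ambFn
  exact (contDiff_const.sub contDiff_tiltFn).sub (contDiff_const.mul (contDiff_sqNorm.sub contDiff_const))

/-- The coefficients of `dF_ν(p) = Σ cᵢ(p) dxᵢ`. [folklore] -/
def ambC (ν : ℝ) (p : 𝔼 5) (i : Fin 5) : ℝ :=
  if i = 3 then -tiltA p - 2 * ν * p 3 else if i = 4 then -tiltB p - 2 * ν * p 4 else -(2 * ν * p i)

/-- The differential of `F_ν`. [folklore] -/
def dAmbFn (ν : ℝ) (p : 𝔼 5) : (𝔼 5) →L[ℝ] ℝ :=
  (-(2 * ν * p 0)) • π 0 + (-(2 * ν * p 1)) • π 1 + (-(2 * ν * p 2)) • π 2 +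
    (-tiltA p - 2 * ν * p 3) • π 3 + (-tiltB p - 2 * ν * p 4) • π 4

/-- `dF_ν(p)` evaluated. [folklore] -/
@[simp] theorem dAmbFn_apply (ν : ℝ) (p v : 𝔼 5) :
    dAmbFn ν p v = -(2 * ν * p 0) * v 0 + -(2 * ν * p 1) * v 1 + -(2 * ν * p 2) * v 2 +
      (-tiltA p - 2 * ν * p 3) * v 3 + (-tiltB p - 2 * ν * p 4) * v 4 := by
  simp [dAmbFn, smul_eq_mul]

/-- `dF_ν = -dG - ν dN`. [folklore] -/
theorem dAmbFn_eq (ν : ℝ) (p : 𝔼 5) : dAmbFn ν p = -dTiltFn p - ν • dSqNorm p := by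
  ext v
  simp [smul_eq_mul]
  ring

/-- `F_ν` is differentiable with differential `dAmbFn`. [folklore] -/
theorem hasFDerivAt_ambFn (ν : ℝ) (p : 𝔼 5) : HasFDerivAt (ambFn ν) (dAmbFn ν p) p := by
  have h := ((hasFDerivAt_const (3 / 2 : ℝ) p).sub (hasFDerivAt_tiltFn p)).sub
    (((hasFDerivAt_sqNorm p).sub_const 1).const_mul ν)
  have h' : HasFDerivAt (ambFn ν) _ p := h.congr_of_eventuallyEq (Eventually.of_forall fun q => rfl)
  refine h'.congr_fderiv ?_
  rw [dAmbFn_eq]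
  ext v
  simp [smul_eq_mul]

/-- `fderiv F_ν = dAmbFn ν`. [folklore] -/
theorem fderiv_ambFn (ν : ℝ) : fderiv ℝ (ambFn ν) = dAmbFn ν :=
  funext fun p => (hasFDerivAt_ambFn ν p).fderiv

/-- `d(G₃)`: the differential of `∂G/∂x₃ = 2x₃ + 6η x₃² + 2η x₄² - η`. [folklore] -/
def dTiltA (p : 𝔼 5) : (𝔼 5) →L[ℝ] ℝ := (2 + 12 * η * p 3) • π 3 + (4 * η * p 4) • π 4
/-- `d(G₄)`: the differential of `∂G/∂x₄ = 2x₄ + 4η x₃ x₄`. [folklore] -/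
def dTiltB (p : 𝔼 5) : (𝔼 5) →L[ℝ] ℝ := (4 * η * p 4) • π 3 + (2 + 4 * η * p 3) • π 4

/-- `d(G₃)(p)` evaluated. [folklore] -/
@[simp] theorem dTiltA_apply (p v : 𝔼 5) :
    dTiltA p v = (2 + 12 * η * p 3) * v 3 + 4 * η * p 4 * v 4 := by
  simp [dTiltA, smul_eq_mul]

/-- `d(G₄)(p)` evaluated. [folklore] -/
@[simp] theorem dTiltB_apply (p v : 𝔼 5) :
    dTiltB p v = 4 * η * p 4 * v 3 + (2 + 4 * η * p 3) * v 4 := by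
  simp [dTiltB, smul_eq_mul]

/-- `G₃` is differentiable with differential `dTiltA`. [folklore] -/
theorem hasFDerivAt_tiltA (p : 𝔼 5) : HasFDerivAt tiltA (dTiltA p) p := by
  have h3 := hasFDerivAt_coord 3 p
  have h4 := hasFDerivAt_coord 4 p
  have h := (((h3.const_mul 2).add ((h3.pow 2).const_mul (6 * η))).add ((h4.pow 2).const_mul (2 * η))).sub_const η
  have h' : HasFDerivAt tiltA _ p := h.congr_of_eventuallyEq (Eventually.of_forall fun q => rfl)
  refine h'.congr_fderiv ?_
  ext v
  simp [dTiltA, smul_eq_mul]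
  ring

/-- `G₄` is differentiable with differential `dTiltB`. [folklore] -/
theorem hasFDerivAt_tiltB (p : 𝔼 5) : HasFDerivAt tiltB (dTiltB p) p := by
  have h3 := hasFDerivAt_coord 3 p
  have h4 := hasFDerivAt_coord 4 p
  have h := (h4.const_mul 2).add (((h3.const_mul (4 * η)).mul h4))
  have h' : HasFDerivAt tiltB _ p := h.congr_of_eventuallyEq (Eventually.of_forall fun q => rfl)
  refine h'.congr_fderiv ?_
  ext v
  simp [dTiltB, smul_eq_mul]
  ring

/-- The coefficient functions of `dF_ν` are differentiable: `d(cᵢ)`. [folklore] -/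
def dAmbC (ν : ℝ) (p : 𝔼 5) (i : Fin 5) : (𝔼 5) →L[ℝ] ℝ :=
  if i = 3 then -dTiltA p - (2 * ν) • π 3 else if i = 4 then -dTiltB p - (2 * ν) • π 4
    else -((2 * ν) • π i)

/-- The second differential of `F_ν` at `p`. [folklore] -/
def d2AmbFn (ν : ℝ) (p : 𝔼 5) : (𝔼 5) →L[ℝ] (𝔼 5) →L[ℝ] ℝ :=
  (-((2 * ν) • π 0)).smulRight (π 0) + (-((2 * ν) • π 1)).smulRight (π 1) +
    (-((2 * ν) • π 2)).smulRight (π 2) + (-dTiltA p - (2 * ν) • π 3).smulRight (π 3) +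
    (-dTiltB p - (2 * ν) • π 4).smulRight (π 4)

/-- `dF_ν` is differentiable with differential `d2AmbFn`. [folklore] -/
theorem hasFDerivAt_dAmbFn (ν : ℝ) (p : 𝔼 5) : HasFDerivAt (dAmbFn ν) (d2AmbFn ν p) p := by
  have h0 : HasFDerivAt (fun q : 𝔼 5 => -(2 * ν * q 0)) (-((2 * ν) • π 0)) p := by
    have := ((hasFDerivAt_coord 0 p).const_mul (2 * ν)).neg
    refine (this.congr_of_eventuallyEq (Eventually.of_forall fun q => rfl)).congr_fderiv ?_
    ext v; simp [smul_eq_mul]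
  have h1 : HasFDerivAt (fun q : 𝔼 5 => -(2 * ν * q 1)) (-((2 * ν) • π 1)) p := by
    have := ((hasFDerivAt_coord 1 p).const_mul (2 * ν)).neg
    refine (this.congr_of_eventuallyEq (Eventually.of_forall fun q => rfl)).congr_fderiv ?_
    ext v; simp [smul_eq_mul]
  have h2 : HasFDerivAt (fun q : 𝔼 5 => -(2 * ν * q 2)) (-((2 * ν) • π 2)) p := by
    have := ((hasFDerivAt_coord 2 p).const_mul (2 * ν)).neg
    refine (this.congr_of_eventuallyEq (Eventually.of_forall fun q => rfl)).congr_fderiv ?_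
    ext v; simp [smul_eq_mul]
  have h3 : HasFDerivAt (fun q : 𝔼 5 => -tiltA q - 2 * ν * q 3) (-dTiltA p - (2 * ν) • π 3) p := by
    have := (hasFDerivAt_tiltA p).neg.sub ((hasFDerivAt_coord 3 p).const_mul (2 * ν))
    refine (this.congr_of_eventuallyEq (Eventually.of_forall fun q => rfl)).congr_fderiv ?_
    ext v; simp [smul_eq_mul]
  have h4 : HasFDerivAt (fun q : 𝔼 5 => -tiltB q - 2 * ν * q 4) (-dTiltB p - (2 * ν) • π 4) p := by
    have := (hasFDerivAt_tiltB p).neg.sub ((hasFDerivAt_coord 4 p).const_mul (2 * ν))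
    refine (this.congr_of_eventuallyEq (Eventually.of_forall fun q => rfl)).congr_fderiv ?_
    ext v; simp [smul_eq_mul]
  have h := ((((h0.smul_const (π 0)).add (h1.smul_const (π 1))).add (h2.smul_const (π 2))).add
    (h3.smul_const (π 3))).add (h4.smul_const (π 4))
  exact h.congr_of_eventuallyEq (Eventually.of_forall fun q => rfl)

/-- The second Fréchet derivative of `F_ν` is `d2AmbFn ν`. [folklore] -/
theorem fderiv_fderiv_ambFn (ν : ℝ) (p : 𝔼 5) : fderiv ℝ (fderiv ℝ (ambFn ν)) p = d2AmbFn ν p := by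
  rw [fderiv_ambFn]
  exact (hasFDerivAt_dAmbFn ν p).fderiv

/-- `d²F_ν(p)` evaluated. [folklore] -/
theorem d2AmbFn_apply_apply (ν : ℝ) (p v w : 𝔼 5) :
    d2AmbFn ν p v w = -(2 * ν * v 0) * w 0 + -(2 * ν * v 1) * w 1 + -(2 * ν * v 2) * w 2 +
      (-(dTiltA p v) - 2 * ν * v 3) * w 3 + (-(dTiltB p v) - 2 * ν * v 4) * w 4 := by
  simp [d2AmbFn, smul_eq_mul]

/-! #### The two critical points `± e₃` and their multipliers -/

/-- The point `s e₃ = (0, 0, 0, s, 0)`. [folklore] -/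
def polePt (s : ℝ) : 𝔼 5 := EuclideanSpace.single 3 s

/-- Coordinates of `s e₃`. [folklore] -/
@[simp] theorem polePt_apply (s : ℝ) (i : Fin 5) : polePt s i = if i = 3 then s else 0 := by
  simp [polePt]

/-- `N(s e₃) = s²`. [folklore] -/
theorem sqNorm_polePt (s : ℝ) : sqNorm (polePt s) = s ^ 2 := by
  simp [sqNorm]

/-- `u(s e₃) = s²`. [folklore] -/
theorem tubeFn_polePt (s : ℝ) : tubeFn (polePt s) = s ^ 2 := by
  simp [tubeFn]

/-- `G(± e₃) = 1 ± η`. [folklore] -/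
theorem tiltFn_polePt {s : ℝ} (hs : s ^ 2 = 1) : tiltFn (polePt s) = 1 + η * s := by
  simp only [tiltFn, polePt_apply]
  simp only [Fin.isValue, ↓reduceIte, Fin.reduceEq]
  linear_combination (1 + 2 * η * s) * hs

/-- **The Lagrange multiplier** at `s e₃` (`s = ±1`): `ν(s) = -1 - (5η/2) s`. [folklore] -/
def mult (s : ℝ) : ℝ := -1 - 5 * η / 2 * s

/-- **`F_{ν(s)}` is critical on `ℝ⁵` at `s e₃`** (`s = ±1`). [folklore] -/
theorem dAmbFn_polePt {s : ℝ} (hs : s ^ 2 = 1) : dAmbFn (mult s) (polePt s) = 0 := by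
  ext v
  rw [dAmbFn_apply, zero_apply]
  simp only [polePt_apply, tiltA, tiltB, mult]
  simp only [Fin.isValue, Fin.reduceEq, ↓reduceIte]
  linear_combination (-η * v 3) * hs

/-- **The Hessian of `F_{ν(s)}` at `s e₃`** (`s = ±1`):
`(2 + 5ηs)(v₀w₀ + v₁w₁ + v₂w₂) - 7ηs v₃w₃ + ηs v₄w₄`. [folklore] -/
theorem d2AmbFn_polePt (s : ℝ) (v w : 𝔼 5) :
    d2AmbFn (mult s) (polePt s) v w =
      (2 + 5 * η * s) * (v 0 * w 0 + v 1 * w 1 + v 2 * w 2) - 7 * η * s * (v 3 * w 3) +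
        η * s * (v 4 * w 4) := by
  rw [d2AmbFn_apply_apply, dTiltA_apply, dTiltB_apply]
  simp only [polePt_apply, mult]
  simp only [Fin.isValue, ↓reduceIte, Fin.reduceEq]
  ring

/-! #### Lagrange's condition for `G` on the unit sphere -/

/-- **Lagrange's condition for `3/2 - G` on the unit sphere, solved on the polar tube.**  If
`N(p) = 1`, `u(p) ≥ 1/2` and `dG(p)` vanishes on `ker dN(p)` (the tangent space of the sphere),
then `p = ± e₃`.  Proof: testing with the tangent vectors `pⱼ eᵢ - pᵢ eⱼ` gives
`pᵢ G₃ = pᵢ G₄ = 0` (`i ≤ 2`) and `p₄ G₃ = p₃ G₄`; if `G₃ = G₄ = 0` then `p₄ = 0` and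
`2p₃ + 6η p₃² - η = 0`, impossible for `p₃² ≥ 1/2`; otherwise `p₀ = p₁ = p₂ = 0`, `u = 1`, and
`p₄ G₃ = p₃ G₄` reads `η p₄ = 0`. [folklore] -/
theorem eq_polePt_of_lagrange {p : 𝔼 5} (hN : sqNorm p = 1) (hu : 1 / 2 ≤ tubeFn p)
    (hL : ∀ v : 𝔼 5, dSqNorm p v = 0 → dTiltFn p v = 0) :
    p = polePt 1 ∨ p = polePt (-1) := by
  simp only [sqNorm] at hN
  simp only [tubeFn] at hu
  -- the test vectors
  have hA : ∀ i : Fin 5, i ≠ 3 → i ≠ 4 → p i * tiltA p = 0 ∧ p i * tiltB p = 0 := by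
    intro i hi3 hi4
    constructor
    · have h := hL (p 3 • EuclideanSpace.single i (1 : ℝ) - p i • EuclideanSpace.single 3 (1 : ℝ)) ?_
      · simp only [dTiltFn_apply, PiLp.sub_apply, PiLp.smul_apply, PiLp.single_apply,
          smul_eq_mul] at h
        simp only [Fin.isValue, hi3.symm, ↓reduceIte, mul_zero, mul_one, zero_sub,
          show (4 : Fin 5) ≠ i from fun h => hi4 h.symm, show (4 : Fin 5) ≠ 3 by decide,
          sub_self, mul_neg] at h
        linarith
      · simp only [dSqNorm_apply, PiLp.sub_apply, PiLp.smul_apply, PiLp.single_apply,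
          smul_eq_mul]
        fin_cases i <;> simp at hi3 hi4 ⊢ <;> ring
    · have h := hL (p 4 • EuclideanSpace.single i (1 : ℝ) - p i • EuclideanSpace.single 4 (1 : ℝ)) ?_
      · simp only [dTiltFn_apply, PiLp.sub_apply, PiLp.smul_apply, PiLp.single_apply,
          smul_eq_mul] at h
        simp only [Fin.isValue, hi4.symm, ↓reduceIte, mul_zero, mul_one, zero_sub,
          show (3 : Fin 5) ≠ i from fun h => hi3 h.symm, show (3 : Fin 5) ≠ 4 by decide,
          sub_self, mul_neg] at h
        linarith
      · simp only [dSqNorm_apply, PiLp.sub_apply, PiLp.smul_apply, PiLp.single_apply,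
          smul_eq_mul]
        fin_cases i <;> simp at hi3 hi4 ⊢ <;> ring
  have hC : p 4 * tiltA p = p 3 * tiltB p := by
    have h := hL (p 4 • EuclideanSpace.single 3 (1 : ℝ) - p 3 • EuclideanSpace.single 4 (1 : ℝ)) ?_
    · simp only [dTiltFn_apply, PiLp.sub_apply, PiLp.smul_apply, PiLp.single_apply,
        smul_eq_mul] at h
      simp at h
      linarith
    · simp only [dSqNorm_apply, PiLp.sub_apply, PiLp.smul_apply, PiLp.single_apply,
        smul_eq_mul]
      simp
      ring
  obtain ⟨h0A, h0B⟩ := hA 0 (by decide) (by decide)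
  obtain ⟨h1A, h1B⟩ := hA 1 (by decide) (by decide)
  obtain ⟨h2A, h2B⟩ := hA 2 (by decide) (by decide)
  have hη := η_eq
  have hp3 : p 3 ^ 2 ≤ 1 := by nlinarith [sq_nonneg (p 0), sq_nonneg (p 1), sq_nonneg (p 2), sq_nonneg (p 4)]
  have hp4 : p 4 ^ 2 ≤ 1 := by nlinarith [sq_nonneg (p 0), sq_nonneg (p 1), sq_nonneg (p 2), sq_nonneg (p 3)]
  have hp3' : -1 ≤ p 3 ∧ p 3 ≤ 1 := by constructor <;> nlinarith [hp3]
  by_cases hAB : tiltA p = 0 ∧ tiltB p = 0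
  · -- ambient critical point of `G`: impossible on the polar tube
    exfalso
    obtain ⟨hA0, hB0⟩ := hAB
    simp only [tiltA, tiltB] at hA0 hB0
    have h4 : p 4 = 0 := by
      have : p 4 * (2 + 4 * η * p 3) = 0 := by linarith
      rcases mul_eq_zero.1 this with h | h
      · exact h
      · exfalso; rw [hη] at h; nlinarith [hp3'.1]
    rw [h4] at hA0 hu
    simp only [ne_eq, OfNat.ofNat_ne_zero, not_false_eq_true, zero_pow, mul_zero, add_zero] at hA0 hu
    rw [hη] at hA0
    rcases le_or_gt 0 (p 3) with h | h
    · nlinarith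
    · nlinarith
  · -- `p₀ = p₁ = p₂ = 0`, then `u = 1` and `η p₄ = 0`
    have hne : tiltA p ≠ 0 ∨ tiltB p ≠ 0 := by tauto
    have h0 : p 0 = 0 := by
      rcases hne with h | h
      · exact (mul_eq_zero.1 h0A).resolve_right h
      · exact (mul_eq_zero.1 h0B).resolve_right h
    have h1 : p 1 = 0 := by
      rcases hne with h | h
      · exact (mul_eq_zero.1 h1A).resolve_right h
      · exact (mul_eq_zero.1 h1B).resolve_right h
    have h2 : p 2 = 0 := by
      rcases hne with h | h
      · exact (mul_eq_zero.1 h2A).resolve_right h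
      · exact (mul_eq_zero.1 h2B).resolve_right h
    rw [h0, h1, h2] at hN
    simp only [ne_eq, OfNat.ofNat_ne_zero, not_false_eq_true, zero_pow, zero_add, add_zero] at hN
    simp only [tiltA, tiltB] at hC
    have h4 : p 4 = 0 := by
      have key : p 4 * (η * (2 * (p 3 ^ 2 + p 4 ^ 2) - 1)) = 0 := by nlinarith
      rw [hN] at key
      rcases mul_eq_zero.1 key with h | h
      · exact h
      · exfalso; rw [hη] at h; norm_num at h
    rw [h4] at hN
    simp only [ne_eq, OfNat.ofNat_ne_zero, not_false_eq_true, zero_pow, add_zero] at hN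
    have h3 : p 3 = 1 ∨ p 3 = -1 := by
      have : (p 3 - 1) * (p 3 + 1) = 0 := by nlinarith
      rcases mul_eq_zero.1 this with h | h
      · left; linarith
      · right; linarith
    rcases h3 with h3 | h3
    · left
      ext i
      fin_cases i <;> simp [h0, h1, h2, h3, h4]
    · right
      ext i
      fin_cases i <;> simp [h0, h1, h2, h3, h4]

/-- Conversely at `± e₃` Lagrange's condition holds: `ker dN = {v₃ = 0}` and `dG = G₃ dx₃`
there. [folklore] -/
theorem lagrange_polePt {s : ℝ} (hs : s ^ 2 = 1) (v : 𝔼 5) (hv : dSqNorm (polePt s) v = 0) :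
    dTiltFn (polePt s) v = 0 := by
  have hs0 : s ≠ 0 := by rintro rfl; norm_num at hs
  simp only [dSqNorm_apply, polePt_apply] at hv
  simp only [Fin.isValue, Fin.reduceEq, ↓reduceIte, mul_zero, zero_mul, add_zero, zero_add,
    mul_eq_zero, OfNat.ofNat_ne_zero, false_or] at hv
  have hv3 : v 3 = 0 := hv.resolve_left hs0
  simp only [dTiltFn_apply, tiltA, tiltB, polePt_apply]
  simp [hv3]

/-- `ker dN(s e₃) = {v | v₃ = 0}` for `s ≠ 0`. [folklore] -/
theorem dSqNorm_polePt_eq_zero_iff {s : ℝ} (hs : s ≠ 0) (v : 𝔼 5) :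
    dSqNorm (polePt s) v = 0 ↔ v 3 = 0 := by
  simp only [dSqNorm_apply, polePt_apply]
  simp [hs]

/-- **The level `{u = 1/2}` of the sphere is regular**: if `N(p) = 1` and `u(p) = 1/2` then
`du(p)` does not vanish on `ker dN(p)`. [folklore] -/
theorem not_lagrange_tubeFn {p : 𝔼 5} (hN : sqNorm p = 1) (hu : tubeFn p = 1 / 2) :
    ¬ ∀ v : 𝔼 5, dSqNorm p v = 0 → dTubeFn p v = 0 := by
  intro hL
  simp only [sqNorm] at hN
  simp only [tubeFn] at hu
  -- test with `p₃ eᵢ - pᵢ e₃` and `p₄ eᵢ - pᵢ e₄`, `i ≤ 2`: `pᵢ p₃ = pᵢ p₄ = 0`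
  have hA : ∀ i : Fin 5, i ≠ 3 → i ≠ 4 → p i * p 3 = 0 ∧ p i * p 4 = 0 := by
    intro i hi3 hi4
    constructor
    · have h := hL (p 3 • EuclideanSpace.single i (1 : ℝ) - p i • EuclideanSpace.single 3 (1 : ℝ)) ?_
      · simp only [dTubeFn_apply, PiLp.sub_apply, PiLp.smul_apply, PiLp.single_apply,
          smul_eq_mul] at h
        simp only [Fin.isValue, hi3.symm, ↓reduceIte, mul_zero, mul_one, zero_sub,
          show (4 : Fin 5) ≠ i from fun h => hi4 h.symm, show (4 : Fin 5) ≠ 3 by decide,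
          sub_self, mul_neg] at h
        nlinarith
      · simp only [dSqNorm_apply, PiLp.sub_apply, PiLp.smul_apply, PiLp.single_apply,
          smul_eq_mul]
        fin_cases i <;> simp at hi3 hi4 ⊢ <;> ring
    · have h := hL (p 4 • EuclideanSpace.single i (1 : ℝ) - p i • EuclideanSpace.single 4 (1 : ℝ)) ?_
      · simp only [dTubeFn_apply, PiLp.sub_apply, PiLp.smul_apply, PiLp.single_apply,
          smul_eq_mul] at h
        simp only [Fin.isValue, hi4.symm, ↓reduceIte, mul_zero, mul_one, zero_sub,
          show (3 : Fin 5) ≠ i from fun h => hi3 h.symm, show (3 : Fin 5) ≠ 4 by decide,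
          sub_self, mul_neg] at h
        nlinarith
      · simp only [dSqNorm_apply, PiLp.sub_apply, PiLp.smul_apply, PiLp.single_apply,
          smul_eq_mul]
        fin_cases i <;> simp at hi3 hi4 ⊢ <;> ring
  obtain ⟨h03, h04⟩ := hA 0 (by decide) (by decide)
  obtain ⟨h13, h14⟩ := hA 1 (by decide) (by decide)
  obtain ⟨h23, h24⟩ := hA 2 (by decide) (by decide)
  -- `pᵢ (p₃² + p₄²) = 0`, so `pᵢ = 0` for `i ≤ 2`, contradicting `N = 1`, `u = 1/2`
  have h0 : p 0 = 0 := by nlinarith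
  have h1 : p 1 = 0 := by nlinarith
  have h2 : p 2 = 0 := by nlinarith
  rw [h0, h1, h2] at hN
  nlinarith

/-! ### §2 The unit sphere of `ℝ⁵` as a regular level; its identification with `𝕊⁴` -/

/-- Criticality of a function on the model manifold `ℝ⁵` is the vanishing of its Fréchet
differential. [folklore] -/
theorem isMCriticalPt_iff_fderiv {F : 𝔼 5 → ℝ} (p : 𝔼 5) :
    IsMCriticalPt (𝓡 5) F p ↔ fderiv ℝ F p = 0 := by
  rw [IsMCriticalPt, mfderiv_eq_fderiv]
  exact Iff.rfl

/-- **`1` is a regular level of the square norm on `ℝ⁵`.** [folklore] -/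
theorem isRegularLevel_sqNorm : IsRegularLevel (𝓡 5) sqNorm 1 where
  contMDiff := contDiff_sqNorm.contMDiff
  isInteriorPoint _ _ := isInteriorPoint_euclidean _
  not_isMCriticalPt := by
    intro x hx hc
    rw [isMCriticalPt_iff_fderiv, fderiv_sqNorm] at hc
    have h := congrArg (fun L : (𝔼 5) →L[ℝ] ℝ => L x) hc
    rw [zero_apply, dSqNorm_apply] at h
    simp only [sqNorm] at hx
    nlinarith

/-- **The level sphere** `S = {x ∈ ℝ⁵ | N(x) = 1}`, a closed smooth `4`-manifold
(`Literature.Topology.FourManifolds.RegularLevel`, charted on `ℝ⁴`). [folklore] -/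
abbrev LevelSphere : Type := RegularLevel isRegularLevel_sqNorm

/-- The inclusion `S → ℝ⁵`. [folklore] -/
abbrev ι : LevelSphere → 𝔼 5 := RegularLevel.incl isRegularLevel_sqNorm

/-- Points of `S` have square norm `1`. [folklore] -/
theorem sqNorm_ι (q : LevelSphere) : sqNorm (ι q) = 1 := RegularLevel.apply_incl _ q

/-- Points of `S` have norm `1`. [folklore] -/
theorem norm_ι (q : LevelSphere) : ‖ι q‖ = 1 := by
  have h := sqNorm_ι q
  rw [sqNorm_eq_norm_sq] at h
  nlinarith [norm_nonneg (ι q)]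

/-- The level `{N = 1}` is the unit sphere of `ℝ⁵`. [folklore] -/
theorem preimage_sqNorm_one : sqNorm ⁻¹' {(1 : ℝ)} = Metric.sphere (0 : 𝔼 5) 1 := by
  ext p
  simp only [mem_preimage, mem_singleton_iff, mem_sphere_iff_norm, sub_zero, sqNorm_eq_norm_sq]
  constructor
  · intro h; nlinarith [norm_nonneg p]
  · intro h; rw [h]; norm_num

/-- `S` is compact (the unit sphere of `ℝ⁵`). [folklore] -/
instance : CompactSpace LevelSphere :=
  (isCompact_iff_compactSpace (X := 𝔼 5) (s := sqNorm ⁻¹' {(1 : ℝ)})).1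
    (by rw [preimage_sqNorm_one]; exact isCompact_sphere 0 1)

/-- The inclusion of Mathlib's unit sphere `𝕊⁴ ⊆ ℝ⁵` is a smooth embedding (smooth, injective,
with injective differential, on a compact manifold: the tree's immersion criterion; Hirsch 1976,
Ch. 1 §3, Thm. 3.1). [folklore] -/
theorem isSmoothEmbedding_val_sphereFour :
    Manifold.IsSmoothEmbedding (𝓡 4) (𝓡 5) ∞ (Subtype.val : (𝕊 4) → 𝔼 5) :=
  isSmoothEmbedding_of_injective_of_injective_mfderiv (contMDiff_coe_sphere (n := 4)) (by simp)
    Subtype.val_injective fun v => mfderiv_coe_sphere_injective v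

/-- The range of the inclusion of `𝕊⁴` is the level `{N = 1}`. [folklore] -/
theorem range_val_sphereFour : range (Subtype.val : (𝕊 4) → 𝔼 5) = sqNorm ⁻¹' {(1 : ℝ)} := by
  rw [Subtype.range_val_subtype, preimage_sqNorm_one]
  rfl

/-- **`S ≅ 𝕊⁴`**: the level sphere is diffeomorphic to Mathlib's unit `4`-sphere, by the tree's
identification of two presentations of a regular level (`IsRegularLevel.presentationHomeomorph`;
the identity on points). [folklore] -/
def sphereLevelDiffeomorph : LevelSphere ≃ₘ⟮𝓡 4, 𝓡 4⟯ (𝕊 4) where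
  toEquiv := (isRegularLevel_sqNorm.presentationHomeomorph isSmoothEmbedding_val_sphereFour
    range_val_sphereFour).toEquiv
  contMDiff_toFun := isRegularLevel_sqNorm.contMDiff_presentationHomeomorph
    isSmoothEmbedding_val_sphereFour range_val_sphereFour
  contMDiff_invFun := isRegularLevel_sqNorm.contMDiff_presentationHomeomorph_symm
    isSmoothEmbedding_val_sphereFour range_val_sphereFour

/-- `S ≅ 𝕊⁴` is the identity on points of `ℝ⁵`. [folklore] -/
theorem coe_sphereLevelDiffeomorph (q : LevelSphere) : ((sphereLevelDiffeomorph q : 𝕊 4) : 𝔼 5) = ι q :=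
  isRegularLevel_sqNorm.apply_presentationHomeomorph isSmoothEmbedding_val_sphereFour
    range_val_sphereFour q

/-- `S` is orientable (as is `𝕊⁴`, `isOrientable_sphere_holds`). [folklore] -/
theorem isOrientable_levelSphere : IsOrientable (𝓡 4) LevelSphere :=
  (isOrientable_sphere_holds 4).of_diffeomorph sphereLevelDiffeomorph.symm (by simp)

/-! ### §3 The tube function on `S`; the two tubes `W₀ = {u ≤ 1/2}`, `V₀ = {u ≥ 1/2}` -/

/-- The tube function `u = x₃² + x₄²` on the level sphere `S`. [folklore] -/
def tubeS (q : LevelSphere) : ℝ := tubeFn (ι q)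

/-- `tubeS = tubeFn ∘ ι`. [folklore] -/
theorem tubeS_eq : tubeS = tubeFn ∘ ι := rfl

/-- `u` is smooth on `S`. [folklore] -/
theorem contMDiff_tubeS : ContMDiff (𝓡 4) 𝓘(ℝ, ℝ) ∞ tubeS :=
  contDiff_tubeFn.contMDiff.comp (RegularLevel.contMDiff_incl _)

/-- The identity chart of `ℝ⁵` is in the maximal atlas. [folklore] -/
theorem refl_mem_maximalAtlas :
    OpenPartialHomeomorph.refl (𝔼 5) ∈ IsManifold.maximalAtlas (𝓡 5) ∞ (𝔼 5) := by
  have h := IsManifold.chart_mem_maximalAtlas (I := 𝓡 5) (n := ∞) (H := 𝔼 5) (0 : 𝔼 5)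
  rwa [chartAt_self_eq] at h

/-- **Critical points of a restricted ambient function on `S`, by Lagrange**: for a smooth `F`
on `ℝ⁵`, `q ∈ S` is critical for `F|S` iff `dF(q)` vanishes on `ker dN(q)`
(`RegularLevel.isMCriticalPt_comp_incl_iff_of_chart` in the identity chart). [cite: Milnor1963, §2] -/
theorem isMCriticalPt_comp_ι_iff {F : 𝔼 5 → ℝ} (hF : ContDiff ℝ ∞ F) (q : LevelSphere) :
    IsMCriticalPt (𝓡 4) (F ∘ ι) q ↔
      ∀ v : 𝔼 5, fderiv ℝ sqNorm (ι q) v = 0 → fderiv ℝ F (ι q) v = 0 := by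
  have h := RegularLevel.isMCriticalPt_comp_incl_iff_of_chart (h := isRegularLevel_sqNorm) (F := F) q
    (hF.contMDiff.of_le (by norm_cast)).contMDiffAt refl_mem_maximalAtlas (by simp)
  exact h

/-- **`1/2` is a regular level of `u` on `S`.** [folklore] -/
theorem isRegularLevel_tubeS : IsRegularLevel (𝓡 4) tubeS (1 / 2) where
  contMDiff := contMDiff_tubeS
  isInteriorPoint _ _ := isInteriorPoint_euclidean _
  not_isMCriticalPt := by
    intro q hq hc
    rw [tubeS_eq, isMCriticalPt_comp_ι_iff contDiff_tubeFn] at hc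
    refine not_lagrange_tubeFn (sqNorm_ι q) hq fun v hv => ?_
    have := hc v (by rw [fderiv_sqNorm]; exact hv)
    rwa [fderiv_tubeFn] at this

/-- **The tube about the equatorial `2`-sphere** `W₀ = {x ∈ S | x₃² + x₄² ≤ 1/2} ≅ S² × D²`, a
compact `4`-manifold with boundary (`RegularSublevel`). [folklore] -/
abbrev EquatorTube : Type := RegularSublevel isRegularLevel_tubeS

/-- **The tube about the polar circle** `V₀ = {x ∈ S | x₃² + x₄² ≥ 1/2} ≅ S¹ × B³`, a compact
`4`-manifold with boundary (`RegularSuperlevel`, i.e. the regular sublevel set `{1/2 - u ≤ 0}`).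
[folklore] -/
abbrev PolarTube : Type := RegularSuperlevel isRegularLevel_tubeS

/-- The regular-level structure defining `V₀` (`1/2 - u` at level `0`). [folklore] -/
abbrev hPolar : IsRegularLevel (𝓡 4) (fun q : LevelSphere => 1 / 2 - tubeS q) 0 :=
  isRegularLevel_tubeS.const_sub

/-- The inclusion `V₀ → S`. [folklore] -/
abbrev ιV : PolarTube → LevelSphere := RegularSublevel.incl hPolar

/-- Points of `V₀` have `u ≥ 1/2`. [folklore] -/
theorem half_le_tubeS_ιV (p : PolarTube) : 1 / 2 ≤ tubeS (ιV p) := by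
  have h : 1 / 2 - tubeS (ιV p) ≤ 0 := RegularSublevel.apply_incl_le hPolar p
  linarith

/-- **The genus-one splitting of the level sphere**: `S = W₀ ∪_{u = 1/2} V₀` in the sense of
`Literature.Topology.FourManifolds.IsBoundaryGluing` (Milnor 1963, Thm. 3.1: `M = Mᵃ ∪ f⁻¹[a, ∞)`).
[cite: Milnor1963, Thm. 3.1] -/
theorem isBoundaryGluing_levelSphere :
    IsBoundaryGluing (RegularSublevel.boundaryData isRegularLevel_tubeS)
      (RegularSublevel.boundaryData hPolar) (RegularSublevel.splitDiffeomorph isRegularLevel_tubeS)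
      (𝓡 4) LevelSphere :=
  RegularSublevel.isBoundaryGluing_split isRegularLevel_tubeS

/-! ### §4 The Morse function `3/2 - G` on `S` and its critical points on the polar tube -/

/-- **The Morse function `3/2 - G` on the level sphere `S`.** [folklore] -/
def morseS (q : LevelSphere) : ℝ := 3 / 2 - tiltFn (ι q)

/-- `morseS` is the restriction of `3/2 - G`. [folklore] -/
theorem morseS_eq : morseS = (fun p : 𝔼 5 => 3 / 2 - tiltFn p) ∘ ι := rfl

/-- `morseS` is the restriction of `F_ν` for every multiplier `ν` (`N = 1` on `S`). [folklore] -/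
theorem morseS_eq_comp (ν : ℝ) : morseS = ambFn ν ∘ ι := by
  funext q
  simp only [comp_apply, ambFn, morseS, sqNorm_ι, sub_self, mul_zero, sub_zero]

/-- `3/2 - G` is smooth on `ℝ⁵`. [folklore] -/
theorem contDiff_const_sub_tiltFn : ContDiff ℝ ∞ (fun p : 𝔼 5 => 3 / 2 - tiltFn p) :=
  contDiff_const.sub contDiff_tiltFn

/-- `d(3/2 - G) = -dG`. [folklore] -/
theorem fderiv_const_sub_tiltFn_apply (p v : 𝔼 5) :
    fderiv ℝ (fun p : 𝔼 5 => 3 / 2 - tiltFn p) p v = -(dTiltFn p v) := by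
  have h : HasFDerivAt (fun p : 𝔼 5 => 3 / 2 - tiltFn p) ((0 : (𝔼 5) →L[ℝ] ℝ) - dTiltFn p) p :=
    (hasFDerivAt_const (3 / 2 : ℝ) p).sub (hasFDerivAt_tiltFn p)
  rw [h.fderiv]
  simp

/-- `morseS` is smooth. [folklore] -/
theorem contMDiff_morseS : ContMDiff (𝓡 4) 𝓘(ℝ, ℝ) ∞ morseS :=
  contDiff_const_sub_tiltFn.contMDiff.comp (RegularLevel.contMDiff_incl _)

/-- **The critical points of `3/2 - G` on the polar tube `{u ≥ 1/2} ⊆ S` are `± e₃`**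
(Lagrange, `eq_polePt_of_lagrange`, `lagrange_polePt`). [cite: Milnor1963, §2] -/
theorem isMCriticalPt_morseS_iff (q : LevelSphere) (hq : 1 / 2 ≤ tubeS q) :
    IsMCriticalPt (𝓡 4) morseS q ↔ ι q = polePt 1 ∨ ι q = polePt (-1) := by
  rw [morseS_eq, isMCriticalPt_comp_ι_iff contDiff_const_sub_tiltFn]
  constructor
  · intro h
    refine eq_polePt_of_lagrange (sqNorm_ι q) hq fun v hv => ?_
    have := h v (by rw [fderiv_sqNorm]; exact hv)
    rwa [fderiv_const_sub_tiltFn_apply, neg_eq_zero] at this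
  · intro h v hv
    rw [fderiv_sqNorm] at hv
    rw [fderiv_const_sub_tiltFn_apply, neg_eq_zero]
    rcases h with h | h
    · rw [h] at hv ⊢; exact lagrange_polePt (by norm_num) v hv
    · rw [h] at hv ⊢; exact lagrange_polePt (by norm_num) v hv

/-- `N(s e₃) = 1` for `s = ±1`. [folklore] -/
theorem sqNorm_polePt_of_sq {s : ℝ} (hs : s ^ 2 = 1) : sqNorm (polePt s) = 1 := by
  rw [sqNorm_polePt, hs]

/-- **The point `s e₃` of `S`** (`s = ±1`). [folklore] -/
def poleS (s : ℝ) (hs : s ^ 2 = 1) : LevelSphere := ⟨polePt s, sqNorm_polePt_of_sq hs⟩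

/-- `ι (s e₃) = s e₃`. [folklore] -/
@[simp] theorem ι_poleS (s : ℝ) (hs : s ^ 2 = 1) : ι (poleS s hs) = polePt s := rfl

/-- `u(s e₃) = 1`. [folklore] -/
theorem tubeS_poleS (s : ℝ) (hs : s ^ 2 = 1) : tubeS (poleS s hs) = 1 := by
  show tubeFn (polePt s) = 1
  rw [tubeFn_polePt, hs]

/-- A point of `S` lying at `s e₃` is `poleS s`. [folklore] -/
theorem eq_poleS_of_ι_eq {q : LevelSphere} {s : ℝ} (hs : s ^ 2 = 1) (h : ι q = polePt s) :
    q = poleS s hs :=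
  Subtype.ext h

/-- **The point `s e₃` of the polar tube `V₀`** (`s = ±1`; `u = 1 ≥ 1/2` there). [folklore] -/
def poleV (s : ℝ) (hs : s ^ 2 = 1) : PolarTube :=
  RegularSublevel.mk hPolar (poleS s hs) (by
    show 1 / 2 - tubeS (poleS s hs) ≤ 0
    rw [tubeS_poleS]; norm_num)

/-- `ιV (s e₃) = s e₃`. [folklore] -/
@[simp] theorem ιV_poleV (s : ℝ) (hs : s ^ 2 = 1) : ιV (poleV s hs) = poleS s hs := rfl

/-- `incl (s e₃) = s e₃` (the same, with the inclusion spelled out). [folklore] -/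
theorem incl_poleV (s : ℝ) (hs : s ^ 2 = 1) : RegularSublevel.incl hPolar (poleV s hs) = poleS s hs :=
  rfl

/-- `e₃ ≠ -e₃` in `V₀`. [folklore] -/
theorem poleV_one_ne : poleV 1 (one_pow 2) ≠ poleV (-1) neg_one_sq := by
  intro h
  have h' := congrArg (fun p : PolarTube => ι (ιV p) 3) h
  simp only [ιV_poleV, ι_poleS, polePt_apply] at h'
  norm_num at h'

/-- `s e₃` lies in the interior of `V₀` (`1/2 - u = -1/2 < 0`). [folklore] -/
theorem poleV_lt (s : ℝ) (hs : s ^ 2 = 1) :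
    (fun q : LevelSphere => 1 / 2 - tubeS q) (ιV (poleV s hs)) < 0 := by
  show 1 / 2 - tubeS (poleS s hs) < 0
  rw [tubeS_poleS]; norm_num

/-! ### §5 The adapted Morse function on the polar tube `V₀` -/

/-- **The Morse function adapted to `∂V₀`**: `3/2 - G` restricted to `V₀`. [folklore] -/
def morseV (p : PolarTube) : ℝ := morseS (ιV p)

/-- `morseV = morseS ∘ incl`. [folklore] -/
theorem morseV_eq : morseV = morseS ∘ RegularSublevel.incl hPolar := rfl

/-- `morseV` is smooth. [folklore] -/
theorem contMDiff_morseV : ContMDiff (𝓡∂ 4) 𝓘(ℝ, ℝ) ∞ morseV :=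
  contMDiff_morseS.comp (RegularSublevel.contMDiff_incl hPolar)

/-- `morseV` in terms of `u` and `x₃`. [folklore] -/
theorem morseV_apply (p : PolarTube) :
    morseV p = 3 / 2 - (tubeS (ιV p) + η * (2 * tubeS (ιV p) - 1) * ι (ιV p) 3) := by
  show 3 / 2 - tiltFn (ι (ιV p)) = _
  rw [tiltFn_eq]
  rfl

/-- The value at the poles: `morseV (s e₃) = 1/2 - η s`. [folklore] -/
theorem morseV_poleV (s : ℝ) (hs : s ^ 2 = 1) : morseV (poleV s hs) = 1 / 2 - η * s := by
  show 3 / 2 - tiltFn (ι (poleS s hs)) = _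
  rw [ι_poleS, tiltFn_polePt hs]
  ring

/-- **The critical points of `morseV` are `e₃` and `-e₃`** (transfer to `S`,
`RegularSublevel.isMCriticalPt_comp_incl_iff`, then Lagrange on `S`).
[cite: Milnor1963, Thm. 3.1] -/
theorem isMCriticalPt_morseV_iff (p : PolarTube) :
    IsMCriticalPt (𝓡∂ 4) morseV p ↔ p = poleV 1 (one_pow 2) ∨ p = poleV (-1) neg_one_sq := by
  rw [morseV_eq, RegularSublevel.isMCriticalPt_comp_incl_iff hPolar contMDiff_morseS p,
    isMCriticalPt_morseS_iff _ (half_le_tubeS_ιV p)]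
  constructor
  · rintro (h | h)
    · exact Or.inl (Subtype.ext (eq_poleS_of_ι_eq (one_pow 2) h))
    · exact Or.inr (Subtype.ext (eq_poleS_of_ι_eq neg_one_sq h))
  · rintro (rfl | rfl)
    · exact Or.inl rfl
    · exact Or.inr rfl

/-! #### Hessians at the poles: the restricted ambient Hessian on the tangent hyperplane -/

/-- The tangent hyperplane `ker dN(x)` of the sphere, read in `ℝ⁵`. [folklore] -/
def tangentKer (x : 𝔼 5) : Submodule ℝ (𝔼 5) :=
  LinearMap.ker ((fderiv ℝ sqNorm x : (𝔼 5) →L[ℝ] ℝ) : (𝔼 5) →ₗ[ℝ] ℝ)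

/-- `ker dN(s e₃) = {v | v₃ = 0}` (`s ≠ 0`). [folklore] -/
theorem mem_tangentKer_polePt_iff {s : ℝ} (hs : s ≠ 0) (v : 𝔼 5) :
    v ∈ tangentKer (polePt s) ↔ v 3 = 0 := by
  rw [tangentKer, LinearMap.mem_ker, fderiv_sqNorm]
  exact dSqNorm_polePt_eq_zero_iff hs v

/-- The Hessian of `F_ν` at `x` in the identity chart of `ℝ⁵` (the second Fréchet derivative,
`hessianInChart_apply_eq`). [cite: Milnor1963, §2] -/
def ambHess (ν : ℝ) (x : 𝔼 5) : LinearMap.BilinForm ℝ (𝔼 5) :=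
  hessianInChart (𝓡 5) (OpenPartialHomeomorph.refl (𝔼 5)) (ambFn ν) x

/-- `ambHess ν x = d²F_ν(x)`. [cite: Milnor1963, §2] -/
theorem ambHess_apply (ν : ℝ) (x v w : 𝔼 5) : ambHess ν x v w = d2AmbFn ν x v w := by
  rw [ambHess, RegularLevel.hessianInChart_apply_eq]
  change fderiv ℝ (fderiv ℝ (ambFn ν)) x v w = _
  rw [fderiv_fderiv_ambFn]

/-- **The Hessian at `s e₃`** (`s = ±1`) on all of `ℝ⁵`:
`(2 + 5ηs)(v₀w₀ + v₁w₁ + v₂w₂) - 7ηs v₃w₃ + ηs v₄w₄`. [cite: Milnor1963, §2] -/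
theorem ambHess_polePt (s : ℝ) (v w : 𝔼 5) :
    ambHess (mult s) (polePt s) v w =
      (2 + 5 * η * s) * (v 0 * w 0 + v 1 * w 1 + v 2 * w 2) + (-(7 * η * s)) * (v 3 * w 3) +
        η * s * (v 4 * w 4) := by
  rw [ambHess_apply, d2AmbFn_polePt]
  ring

/-- `F_{ν(s)}` is critical on `ℝ⁵` at `s e₃`. [folklore] -/
theorem isMCriticalPt_ambFn_polePt {s : ℝ} (hs : s ^ 2 = 1) :
    IsMCriticalPt (𝓡 5) (ambFn (mult s)) (polePt s) := by
  rw [isMCriticalPt_iff_fderiv, fderiv_ambFn]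
  exact dAmbFn_polePt hs

/-- **Nondegeneracy of `Hess(3/2 - G)|S` at `s e₃` is that of the restricted ambient Hessian**
(`RegularLevel.nondegenerate_mhessian_comp_incl_iff` in the identity chart). [cite: Milnor1963, §2] -/
theorem nondegenerate_mhessian_morseS_iff {s : ℝ} (hs : s ^ 2 = 1) :
    (mhessian (𝓡 4) morseS (poleS s hs)).Nondegenerate ↔
      ((ambHess (mult s) (polePt s)).restrict (tangentKer (polePt s))).Nondegenerate := by
  rw [morseS_eq_comp (mult s)]
  exact RegularLevel.nondegenerate_mhessian_comp_incl_iff (h := isRegularLevel_sqNorm) (poleS s hs)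
    (((contDiff_ambFn _).contMDiff.of_le (by norm_cast)).contMDiffAt) (isMCriticalPt_ambFn_polePt hs)
    refl_mem_maximalAtlas (by simp)

/-- **The Morse index of `(3/2 - G)|S` at `s e₃` is the negative index of inertia of the
restricted ambient Hessian** (`RegularLevel.morseIndex_comp_incl_eq`). [cite: Milnor1963, §2] -/
theorem morseIndex_morseS_eq {s : ℝ} (hs : s ^ 2 = 1) :
    morseIndex (𝓡 4) morseS (poleS s hs) =
      sigNeg ((ambHess (mult s) (polePt s)).restrict (tangentKer (polePt s))).toQuadraticMap := by
  rw [morseS_eq_comp (mult s)]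
  exact RegularLevel.morseIndex_comp_incl_eq (h := isRegularLevel_sqNorm) (poleS s hs)
    (((contDiff_ambFn _).contMDiff.of_le (by norm_cast)).contMDiffAt) (isMCriticalPt_ambFn_polePt hs)
    refl_mem_maximalAtlas (by simp)

/-! #### Sylvester on the hyperplane `{v₃ = 0}` of `ℝ⁵` -/

section Restrict

variable {V : Submodule ℝ (𝔼 5)} {B : LinearMap.BilinForm ℝ (𝔼 5)} {a b c : ℝ}

/-- A form `a(v₀w₀ + v₁w₁ + v₂w₂) + c v₃w₃ + b v₄w₄` with `a, b > 0` is positive definite on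
`V = {v₃ = 0}`. [cite: Milnor1963, §2] -/
theorem posDef_restrict_of_apply_eq (ha : 0 < a) (hb : 0 < b)
    (hB : ∀ v w, B v w = a * (v 0 * w 0 + v 1 * w 1 + v 2 * w 2) + c * (v 3 * w 3) + b * (v 4 * w 4))
    (hV : ∀ v, v ∈ V ↔ v 3 = 0) :
    (B.restrict V).toQuadraticMap.PosDef := by
  intro x hx
  have hx3 : (x : 𝔼 5) 3 = 0 := (hV _).1 x.2
  have hne : (x : 𝔼 5) 0 ≠ 0 ∨ (x : 𝔼 5) 1 ≠ 0 ∨ (x : 𝔼 5) 2 ≠ 0 ∨ (x : 𝔼 5) 4 ≠ 0 := by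
    by_contra h
    simp only [not_or, not_not] at h
    apply hx
    refine Subtype.ext ?_
    ext i
    fin_cases i
    · simpa using h.1
    · simpa using h.2.1
    · simpa using h.2.2.1
    · simpa using hx3
    · simpa using h.2.2.2
  simp only [LinearMap.BilinMap.toQuadraticMap_apply, LinearMap.BilinForm.restrict_apply,
    LinearMap.domRestrict_apply, hB, hx3, mul_zero, add_zero]
  rcases hne with h | h | h | h
  · have := sq_pos_of_ne_zero h
    nlinarith [sq_nonneg ((x : 𝔼 5) 1), sq_nonneg ((x : 𝔼 5) 2), sq_nonneg ((x : 𝔼 5) 4),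
      mul_pos ha this, mul_nonneg hb.le (sq_nonneg ((x : 𝔼 5) 4))]
  · have := sq_pos_of_ne_zero h
    nlinarith [sq_nonneg ((x : 𝔼 5) 0), sq_nonneg ((x : 𝔼 5) 2), sq_nonneg ((x : 𝔼 5) 4),
      mul_pos ha this, mul_nonneg hb.le (sq_nonneg ((x : 𝔼 5) 4))]
  · have := sq_pos_of_ne_zero h
    nlinarith [sq_nonneg ((x : 𝔼 5) 0), sq_nonneg ((x : 𝔼 5) 1), sq_nonneg ((x : 𝔼 5) 4),
      mul_pos ha this, mul_nonneg hb.le (sq_nonneg ((x : 𝔼 5) 4))]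
  · have := sq_pos_of_ne_zero h
    nlinarith [sq_nonneg ((x : 𝔼 5) 0), sq_nonneg ((x : 𝔼 5) 1), sq_nonneg ((x : 𝔼 5) 2),
      mul_pos hb this, mul_nonneg ha.le (sq_nonneg ((x : 𝔼 5) 0)),
      mul_nonneg ha.le (sq_nonneg ((x : 𝔼 5) 1)), mul_nonneg ha.le (sq_nonneg ((x : 𝔼 5) 2))]

/-- **Index `0`**: with `a, b > 0` the restricted form is nondegenerate of negative index of
inertia `0`. [cite: Milnor1963, §2] -/
theorem nondegenerate_and_sigNeg_eq_zero_of_apply_eq (ha : 0 < a) (hb : 0 < b)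
    (hB : ∀ v w, B v w = a * (v 0 * w 0 + v 1 * w 1 + v 2 * w 2) + c * (v 3 * w 3) + b * (v 4 * w 4))
    (hV : ∀ v, v ∈ V ↔ v 3 = 0) :
    (B.restrict V).Nondegenerate ∧ sigNeg (B.restrict V).toQuadraticMap = 0 := by
  have hpd := posDef_restrict_of_apply_eq ha hb hB hV
  refine ⟨⟨fun x hx => ?_, fun x hx => ?_⟩, LinearMap.BilinForm.sigNeg_eq_zero_of_posDef hpd⟩
  · by_contra h0
    have := hpd x h0
    simp only [LinearMap.BilinMap.toQuadraticMap_apply, hx x] at this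
    exact lt_irrefl _ this
  · by_contra h0
    have := hpd x h0
    simp only [LinearMap.BilinMap.toQuadraticMap_apply, hx x] at this
    exact lt_irrefl _ this

/-- The basis vectors `eᵢ` of `ℝ⁵`. [folklore] -/
abbrev E5 (i : Fin 5) : 𝔼 5 := EuclideanSpace.single i (1 : ℝ)

/-- Coordinates of `eᵢ`. [folklore] -/
@[simp] theorem E5_apply (i j : Fin 5) : E5 i j = if j = i then 1 else 0 := by
  simp [E5]

/-- **Index `1`**: with `a > 0 > b` the restricted form on `V = {v₃ = 0}` is nondegenerate of
negative index of inertia `1` (the negative line `ℝ e₄` splits off the positive definite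
`3`-space `{v₃ = v₄ = 0}`; `sigNeg_eq_of_proj`). [cite: Milnor1963, §2] -/
theorem nondegenerate_and_sigNeg_eq_one_of_apply_eq (ha : 0 < a) (hb : b < 0)
    (hB : ∀ v w, B v w = a * (v 0 * w 0 + v 1 * w 1 + v 2 * w 2) + c * (v 3 * w 3) + b * (v 4 * w 4))
    (hV : ∀ v, v ∈ V ↔ v 3 = 0) :
    (B.restrict V).Nondegenerate ∧ sigNeg (B.restrict V).toQuadraticMap = 1 := by
  have hE0 : E5 0 ∈ V := (hV _).2 (by simp)
  have hE1 : E5 1 ∈ V := (hV _).2 (by simp)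
  have hE2 : E5 2 ∈ V := (hV _).2 (by simp)
  have hE4 : E5 4 ∈ V := (hV _).2 (by simp)
  -- nondegeneracy: test against `e₀, e₁, e₂, e₄ ∈ V`
  have hsep : ∀ x : V, (∀ y : V, B x y = 0) → x = 0 := by
    intro x hx
    have hx3 : (x : 𝔼 5) 3 = 0 := (hV _).1 x.2
    have h0 := hx ⟨E5 0, hE0⟩
    have h1 := hx ⟨E5 1, hE1⟩
    have h2 := hx ⟨E5 2, hE2⟩
    have h4 := hx ⟨E5 4, hE4⟩
    simp only [hB, E5_apply] at h0 h1 h2 h4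
    simp only [Fin.isValue, ↓reduceIte, mul_one, Fin.reduceEq, mul_zero, add_zero, zero_add,
      mul_eq_zero, ha.ne', hb.ne, false_or] at h0 h1 h2 h4
    refine Subtype.ext ?_
    ext i
    fin_cases i
    · simpa using h0
    · simpa using h1
    · simpa using h2
    · simpa using hx3
    · simpa using h4
  have hsymm : ∀ x y : V, B x y = B y x := fun x y => by
    rw [hB, hB]; ring
  refine ⟨⟨fun x hx => hsep x (fun y => by simpa using hx y),
    fun x hx => hsep x (fun y => by rw [hsymm]; simpa using hx y)⟩, ?_⟩
  -- the index: project to the `v₄`-line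
  let πr : V →ₗ[ℝ] ℝ := ((π 4 : (𝔼 5) →L[ℝ] ℝ) : (𝔼 5) →ₗ[ℝ] ℝ).comp V.subtype
  let ιr : ℝ →ₗ[ℝ] V := LinearMap.codRestrict V (LinearMap.toSpanSingleton ℝ (𝔼 5) (E5 4))
    (fun t => V.smul_mem t hE4)
  let Q' : QuadraticForm ℝ ℝ :=
    LinearMap.BilinMap.toQuadraticMap (b • (LinearMap.mul ℝ ℝ : ℝ →ₗ[ℝ] ℝ →ₗ[ℝ] ℝ))
  have hQ' : ∀ t : ℝ, Q' t = b * (t * t) := fun t => by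
    simp [Q']
  have hQ : ∀ x : V, (B.restrict V).toQuadraticMap x =
      a * ((x : 𝔼 5) 0 * (x : 𝔼 5) 0 + (x : 𝔼 5) 1 * (x : 𝔼 5) 1 + (x : 𝔼 5) 2 * (x : 𝔼 5) 2) +
        b * ((x : 𝔼 5) 4 * (x : 𝔼 5) 4) := fun x => by
    have hx3 : (x : 𝔼 5) 3 = 0 := (hV _).1 x.2
    simp [LinearMap.BilinMap.toQuadraticMap_apply, hB, hx3]
  have key : sigNeg (B.restrict V).toQuadraticMap = sigNeg Q' := by
    refine sigNeg_eq_of_proj _ Q' πr ιr (fun x => ?_) (fun x hx => ?_) (fun t => ?_) (fun t => ?_)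
    · rw [hQ, hQ']
      simp only [πr, LinearMap.coe_comp, Submodule.coe_subtype, comp_apply, ContinuousLinearMap.coe_coe,
        π_apply]
      nlinarith [sq_nonneg ((x : 𝔼 5) 0), sq_nonneg ((x : 𝔼 5) 1), sq_nonneg ((x : 𝔼 5) 2),
        mul_nonneg ha.le (sq_nonneg ((x : 𝔼 5) 0)), mul_nonneg ha.le (sq_nonneg ((x : 𝔼 5) 1)),
        mul_nonneg ha.le (sq_nonneg ((x : 𝔼 5) 2))]
    · simp only [πr, LinearMap.coe_comp, Submodule.coe_subtype, comp_apply, ContinuousLinearMap.coe_coe,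
        π_apply] at hx
      rw [hQ, hx]
      nlinarith [sq_nonneg ((x : 𝔼 5) 0), sq_nonneg ((x : 𝔼 5) 1), sq_nonneg ((x : 𝔼 5) 2),
        mul_nonneg ha.le (sq_nonneg ((x : 𝔼 5) 0)), mul_nonneg ha.le (sq_nonneg ((x : 𝔼 5) 1)),
        mul_nonneg ha.le (sq_nonneg ((x : 𝔼 5) 2))]
    · rw [hQ, hQ']
      simp [ιr]
    · simp [πr, ιr]
  rw [key]
  -- `sigNeg (b t²) = 1` on the line, `b < 0`
  apply le_antisymm
  · calc sigNeg Q' = sigPos (-Q') := by rw [sigPos_neg]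
      _ ≤ Module.finrank ℝ ℝ := sigPos_le_finrank _
      _ = 1 := Module.finrank_self ℝ
  · have hneg : ((-Q').restrict ⊤).PosDef := by
      intro t ht
      have ht' : (t : ℝ) ≠ 0 := fun h => ht (Subtype.ext h)
      simp only [QuadraticMap.restrict_apply, QuadraticMap.neg_apply, hQ']
      nlinarith [mul_pos (neg_pos.2 hb) (mul_self_pos.2 ht')]
    have := le_sigNeg_of_negDef Q' hneg
    rw [finrank_top, Module.finrank_self] at this
    exact this

end Restrict

/-- **At `e₃` the restricted Hessian is nondegenerate of index `0`** (`a = 2 + 5η > 0`,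
`b = η > 0`). [cite: Milnor1963, §2] -/
theorem nondegenerate_and_sigNeg_one :
    ((ambHess (mult 1) (polePt 1)).restrict (tangentKer (polePt 1))).Nondegenerate ∧
      sigNeg ((ambHess (mult 1) (polePt 1)).restrict (tangentKer (polePt 1))).toQuadraticMap = 0 :=
  nondegenerate_and_sigNeg_eq_zero_of_apply_eq (a := 2 + 5 * η * 1) (b := η * 1) (c := -(7 * η * 1))
    (by rw [η_eq]; norm_num) (by rw [η_eq]; norm_num) (ambHess_polePt 1)
    (mem_tangentKer_polePt_iff one_ne_zero)

/-- **At `-e₃` the restricted Hessian is nondegenerate of index `1`** (`a = 2 - 5η > 0`,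
`b = -η < 0`). [cite: Milnor1963, §2] -/
theorem nondegenerate_and_sigNeg_neg_one :
    ((ambHess (mult (-1)) (polePt (-1))).restrict (tangentKer (polePt (-1)))).Nondegenerate ∧
      sigNeg ((ambHess (mult (-1)) (polePt (-1))).restrict (tangentKer (polePt (-1)))).toQuadraticMap
        = 1 :=
  nondegenerate_and_sigNeg_eq_one_of_apply_eq (a := 2 + 5 * η * (-1)) (b := η * (-1))
    (c := -(7 * η * (-1))) (by rw [η_eq]; norm_num) (by rw [η_eq]; norm_num) (ambHess_polePt (-1))
    (mem_tangentKer_polePt_iff (by norm_num))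

/-! #### Morse data of `morseV` -/

/-- **`morseV` has nondegenerate Hessian at its critical points.** [cite: Milnor1963, Thm. 3.1] -/
theorem nondegenerate_mhessian_morseV {p : PolarTube} (hp : IsMCriticalPt (𝓡∂ 4) morseV p) :
    (mhessian (𝓡∂ 4) morseV p).Nondegenerate := by
  rcases (isMCriticalPt_morseV_iff p).1 hp with rfl | rfl
  · rw [morseV_eq, RegularSublevel.nondegenerate_mhessian_comp_incl_iff hPolar morseS _ (poleV_lt 1 (one_pow 2)),
      incl_poleV, nondegenerate_mhessian_morseS_iff]
    exact nondegenerate_and_sigNeg_one.1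
  · rw [morseV_eq, RegularSublevel.nondegenerate_mhessian_comp_incl_iff hPolar morseS _
      (poleV_lt (-1) neg_one_sq), incl_poleV, nondegenerate_mhessian_morseS_iff]
    exact nondegenerate_and_sigNeg_neg_one.1

/-- **`morseV` is a Morse function.** [cite: Milnor1963, §2] -/
theorem isMorse_morseV : IsMorse (𝓡∂ 4) morseV :=
  ⟨contMDiff_morseV, fun _ hp => nondegenerate_mhessian_morseV hp⟩

/-- **The index at `e₃` is `0`** (the minimum). [cite: Milnor1963, Thm. 3.1] -/
theorem morseIndex_morseV_poleV_one : morseIndex (𝓡∂ 4) morseV (poleV 1 (one_pow 2)) = 0 := by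
  rw [morseV_eq, RegularSublevel.morseIndex_comp_incl_eq hPolar morseS _ (poleV_lt 1 (one_pow 2)),
    incl_poleV, morseIndex_morseS_eq]
  exact nondegenerate_and_sigNeg_one.2

/-- **The index at `-e₃` is `1`.** [cite: Milnor1963, Thm. 3.1] -/
theorem morseIndex_morseV_poleV_neg_one : morseIndex (𝓡∂ 4) morseV (poleV (-1) neg_one_sq) = 1 := by
  rw [morseV_eq, RegularSublevel.morseIndex_comp_incl_eq hPolar morseS _ (poleV_lt (-1) neg_one_sq),
    incl_poleV, morseIndex_morseS_eq]
  exact nondegenerate_and_sigNeg_neg_one.2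

/-- Points of `S` have `|x₃| ≤ 1`. [folklore] -/
theorem abs_apply_three_le (q : LevelSphere) : -1 ≤ ι q 3 ∧ ι q 3 ≤ 1 := by
  have h := sqNorm_ι q
  simp only [sqNorm] at h
  have h3 : ι q 3 ^ 2 ≤ 1 := by
    nlinarith [sq_nonneg (ι q 0), sq_nonneg (ι q 1), sq_nonneg (ι q 2), sq_nonneg (ι q 4)]
  constructor <;> nlinarith [h3]

/-- **`morseV` is a Morse function adapted to the boundary of `V₀`**: `= 1` and regular on
`∂V₀ = {u = 1/2}` (where the tilt `η (2u - 1) x₃` vanishes), `< 1` inside (`u > 1/2`).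
[cite: MilnorHCobordism1965, Def. 3.1] -/
theorem isMorseAdapted_morseV : IsMorseAdapted (𝓡∂ 4) morseV := by
  refine ⟨isMorse_morseV, fun x hx => ?_, fun x hx => ?_⟩
  · have hb : 1 / 2 - tubeS (ιV x) = 0 := (RegularSublevel.mem_boundary_iff hPolar x).1 hx
    have hu : tubeS (ιV x) = 1 / 2 := by linarith
    constructor
    · rw [morseV_apply, hu]; ring
    · intro hc
      rcases (isMCriticalPt_morseV_iff x).1 hc with rfl | rfl
      · rw [ιV_poleV, tubeS_poleS] at hu; norm_num at hu
      · rw [ιV_poleV, tubeS_poleS] at hu; norm_num at hu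
  · have hi : 1 / 2 - tubeS (ιV x) < 0 := (RegularSublevel.isInteriorPoint_iff hPolar x).1 hx
    rw [morseV_apply]
    obtain ⟨h1, h2⟩ := abs_apply_three_le (ιV x)
    have hη := η_eq
    nlinarith [mul_nonneg (show (0 : ℝ) ≤ 2 * tubeS (ιV x) - 1 by linarith) (show (0 : ℝ) ≤ ι (ιV x) 3 + 1 by linarith)]

/-! ### §6 The handle decomposition of `V₀`: one `0`-handle, one `1`-handle -/

/-- The critical points of `morseV` of index `0`: `{e₃}`. [cite: Milnor1963, Thm. 3.1] -/
theorem criticalSetOfIndex_morseV_zero :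
    criticalSetOfIndex (𝓡∂ 4) morseV 0 = {poleV 1 (one_pow 2)} := by
  ext p
  simp only [mem_criticalSetOfIndex, mem_singleton_iff]
  constructor
  · rintro ⟨hc, hi⟩
    rcases (isMCriticalPt_morseV_iff p).1 hc with rfl | rfl
    · rfl
    · rw [morseIndex_morseV_poleV_neg_one] at hi; exact absurd hi one_ne_zero
  · rintro rfl
    exact ⟨(isMCriticalPt_morseV_iff _).2 (Or.inl rfl), morseIndex_morseV_poleV_one⟩

/-- The critical points of `morseV` of index `1`: `{-e₃}`. [cite: Milnor1963, Thm. 3.1] -/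
theorem criticalSetOfIndex_morseV_one :
    criticalSetOfIndex (𝓡∂ 4) morseV 1 = {poleV (-1) neg_one_sq} := by
  ext p
  simp only [mem_criticalSetOfIndex, mem_singleton_iff]
  constructor
  · rintro ⟨hc, hi⟩
    rcases (isMCriticalPt_morseV_iff p).1 hc with rfl | rfl
    · rw [morseIndex_morseV_poleV_one] at hi; exact absurd hi zero_ne_one
    · rfl
  · rintro rfl
    exact ⟨(isMCriticalPt_morseV_iff _).2 (Or.inr rfl), morseIndex_morseV_poleV_neg_one⟩

/-- `morseV` has no critical points of index `≥ 2`. [cite: Milnor1963, Thm. 3.1] -/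
theorem criticalSetOfIndex_morseV_of_two_le {k : ℕ} (hk : 2 ≤ k) :
    criticalSetOfIndex (𝓡∂ 4) morseV k = ∅ := by
  ext p
  simp only [mem_criticalSetOfIndex, mem_empty_iff_false, iff_false, not_and]
  intro hc hi
  rcases (isMCriticalPt_morseV_iff p).1 hc with rfl | rfl
  · rw [morseIndex_morseV_poleV_one] at hi; omega
  · rw [morseIndex_morseV_poleV_neg_one] at hi; omega

/-- **The polar tube `V₀ = {u ≥ 1/2} ⊆ S` has a handle decomposition with one `0`-handle and one
`1`-handle** (it is `S¹ × B³`): the adapted Morse function `3/2 - G`.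
[cite: Milnor1963, Thm. 3.1 and §3] [cite: Kosinski1993, VI (11.4)(c)] -/
theorem hasHandleDecomposition_polarTube : HasHandleDecomposition 3 PolarTube (handleCount 1 1) := by
  refine ⟨morseV, isMorseAdapted_morseV, fun k => ?_⟩
  rcases k with _ | _ | k
  · rw [criticalSetOfIndex_morseV_zero, ncard_singleton, handleCount_zero]
  · rw [criticalSetOfIndex_morseV_one, ncard_singleton, handleCount_one]
  · rw [criticalSetOfIndex_morseV_of_two_le (by omega), ncard_empty]
    simp [handleCount]

/-- **`V₀` is a handlebody with handles of index `≤ 1`.** [cite: Kosinski1993, VII.1.2] -/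
theorem isHandlebodyOfIndexLE_polarTube : IsHandlebodyOfIndexLE 3 1 PolarTube := by
  refine ⟨morseV, isMorseAdapted_morseV, fun p hp => ?_⟩
  rcases (isMCriticalPt_morseV_iff p).1 hp with rfl | rfl
  · rw [morseIndex_morseV_poleV_one]; exact zero_le_one
  · rw [morseIndex_morseV_poleV_neg_one]

/-- `V₀` is connected (one `0`-handle; Reeb's argument). [cite: Milnor1963, §3 and proof of Thm. 4.1] -/
instance : ConnectedSpace PolarTube :=
  hasHandleDecomposition_polarTube.connectedSpace (handleCount_zero 1 1)

/-- `V₀` is orientable (a regular domain of the orientable `S ≅ 𝕊⁴`). [cite: HirschDT1976, §4.4 p. 101] -/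
theorem isOrientable_polarTube : IsOrientable (𝓡∂ 4) PolarTube :=
  RegularSublevel.isOrientable hPolar isOrientable_levelSphere

/-! ### §7 Four-sphere recognition from a genus-one splitting, modulo Laudenbach–Poénaru -/

/-- **`S⁴` from a genus-one splitting `W₀ ∪_φ V`, modulo Laudenbach–Poénaru** (Auroux–Donaldson–
Katzarkov 2005, §8.2, Example 1, last sentence: *"we now have `X_- ∪ W ≃ S¹ × B³`, and by
gluing `X_+ = D² × S²` along the boundary we obtain `X' ≃ S⁴`"*; Baykur–Kamada 2015, §5, case
`n = 1`; the implicit input being that every self-diffeomorphism of `S¹ × S²` extends over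
`S¹ × B³`, Laudenbach–Poénaru 1972 — the tree's `exists_diffeomorph_comp_incl_eq` — so that the
gluing map does not matter, Gompf–Stipsicz 1999, §4.4; Kirby 1989, Ch. I §2, p. 8).  Let `X` be a
smooth `4`-manifold which is the boundary gluing of the equatorial tube
`W₀ = {x ∈ S | x₃² + x₄² ≤ 1/2} ≅ S² × D²` of the level sphere `S = {Σ xᵢ² = 1} ⊆ ℝ⁵` and of a
compact connected orientable `4`-manifold with boundary `V` carrying a handle decomposition with
one `0`-handle and one `1`-handle (`≅ S¹ × B³`, Kosinski 1993, VI (11.4)(c)).  Then, granted the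
Laudenbach–Poénaru extension fact, `X ≅ 𝕊⁴`.  Proof: `V₀ ≅ V` by the PROVED classification of
orientable `4`-dimensional `(1, k)`-handlebodies
(`nonempty_diffeomorph_of_hasHandleDecomposition_handleCount_one_holds`, `k = 1`), `S = W₀ ∪ V₀`
(`isBoundaryGluing_levelSphere`), Kirby's sentence
`nonempty_diffeomorph_of_isBoundaryGluing_of_laudenbachPoenaru_of_diffeomorph` (Matsumoto 2001,
Lemma 5.20), and `S ≅ 𝕊⁴` (`sphereLevelDiffeomorph`).
[cite: AurouxDonaldsonKatzarkov2005, §8.2 Example 1] [cite: BaykurKamada2015, §5]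
[cite: LaudenbachPoenaruBSMF1972, main theorem] [cite: Matsumoto2001, Lemma 5.20] -/
theorem nonempty_diffeomorph_sphere_four_of_isBoundaryGluing_equatorTube
    (hLP : exists_diffeomorph_comp_incl_eq.{0})
    {X : Type} [TopologicalSpace X] [ChartedSpace (𝔼 4) X] [IsManifold (𝓡 4) ∞ X]
    {V : Type} [TopologicalSpace V] [T2Space V] [SecondCountableTopology V] [CompactSpace V]
    [ConnectedSpace V] [ChartedSpace (EuclideanHalfSpace 4) V] [IsManifold (𝓡∂ 4) ∞ V]
    (hV : HasHandleDecomposition 3 V (handleCount 1 1)) (hoV : IsOrientable (𝓡∂ 4) V)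
    {bV : BoundaryData (𝓡∂ 4) V (𝓡 3)}
    {φ : (RegularSublevel.boundaryData isRegularLevel_tubeS).carrier ≃ₘ⟮𝓡 3, 𝓡 3⟯ bV.carrier}
    (hX : IsBoundaryGluing (RegularSublevel.boundaryData isRegularLevel_tubeS) bV φ (𝓡 4) X) :
    Nonempty (X ≃ₘ⟮𝓡 4, 𝓡 4⟯ (𝕊 4)) := by
  obtain ⟨Ψ⟩ := nonempty_diffeomorph_of_hasHandleDecomposition_handleCount_one_holds 1 PolarTube V
    hasHandleDecomposition_polarTube isOrientable_polarTube hV hoV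
  obtain ⟨Θ⟩ := nonempty_diffeomorph_of_isBoundaryGluing_of_laudenbachPoenaru_of_diffeomorph hLP
    isHandlebodyOfIndexLE_polarTube isOrientable_polarTube Ψ isBoundaryGluing_levelSphere hX
  exact ⟨Θ.symm.trans sphereLevelDiffeomorph⟩

/-- **`S⁴` from a genus-one splitting, the `S² × D²` piece up to diffeomorphism** (same
statement with the first piece any `W` diffeomorphic to the equatorial tube `W₀`, transported by
`IsBoundaryGluing.transfer`). [cite: AurouxDonaldsonKatzarkov2005, §8.2 Example 1]
[cite: LaudenbachPoenaruBSMF1972, main theorem] -/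
theorem nonempty_diffeomorph_sphere_four_of_isBoundaryGluing_of_diffeomorph_equatorTube
    (hLP : exists_diffeomorph_comp_incl_eq.{0})
    {X : Type} [TopologicalSpace X] [ChartedSpace (𝔼 4) X] [IsManifold (𝓡 4) ∞ X]
    {W : Type} [TopologicalSpace W] [ChartedSpace (EuclideanHalfSpace 4) W] [IsManifold (𝓡∂ 4) ∞ W]
    (Ξ : EquatorTube ≃ₘ⟮𝓡∂ 4, 𝓡∂ 4⟯ W)
    {V : Type} [TopologicalSpace V] [T2Space V] [SecondCountableTopology V] [CompactSpace V]
    [ConnectedSpace V] [ChartedSpace (EuclideanHalfSpace 4) V] [IsManifold (𝓡∂ 4) ∞ V]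
    (hV : HasHandleDecomposition 3 V (handleCount 1 1)) (hoV : IsOrientable (𝓡∂ 4) V)
    {bW : BoundaryData (𝓡∂ 4) W (𝓡 3)} {bV : BoundaryData (𝓡∂ 4) V (𝓡 3)}
    {φ : bW.carrier ≃ₘ⟮𝓡 3, 𝓡 3⟯ bV.carrier} (hX : IsBoundaryGluing bW bV φ (𝓡 4) X) :
    Nonempty (X ≃ₘ⟮𝓡 4, 𝓡 4⟯ (𝕊 4)) :=
  nonempty_diffeomorph_sphere_four_of_isBoundaryGluing_equatorTube hLP hV hoV
    (φ := ((RegularSublevel.boundaryData isRegularLevel_tubeS).restrictDiffeomorph bW Ξ).trans φ)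
    (hX.transfer (b₁ := RegularSublevel.boundaryData isRegularLevel_tubeS) Ξ)

end SphereFourSplitting

end Literature.Topology.FourManifolds
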